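import Mathlib
import Summits.Ventures.PercRepro2.Defs
import Summits.Ventures.PercRepro2.Independence
import Summits.Ventures.PercRepro2.Harris
import Summits.Ventures.PercRepro2.Graph
import Summits.Ventures.PercRepro2.Exploration
import Summits.Ventures.PercRepro2.Events
import Summits.Ventures.PercRepro2.FourFunctions
import Summits.Ventures.PercRepro2.Induced
import Summits.Ventures.PercRepro2.Frontier
import Summits.Ventures.PercRepro2.ObsIndependence
import Summits.Ventures.PercRepro2.BHK
import Summits.Ventures.PercRepro2.BHKEvents
import Summits.Ventures.PercRepro2.OrderPreservation
import Summits.Ventures.PercRepro2.BHKAvoid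
import Summits.Ventures.PercRepro2.SameClusterAvoid
import Summits.Ventures.PercRepro2.CaseOneRegime
import Summits.Ventures.PercRepro2.CaseOnePos
import Summits.Ventures.PercRepro2.CaseOneJ11
import Summits.Ventures.PercRepro2.CaseOneRV
import Summits.Ventures.PercRepro2.CaseOnePendant

/-!
# The pendant-`a₃` REDUCTION: `(ii)` for `a₃` a leaf at ANY vertex `v` follows from `(ii)` and `(ii-Q)`
for the instance with `v` in the `a₃` slot (blind cell PercRepro2, p1 g13; S5 §2.1 (K8), P1-CASEONE.md §7)

`(ii)` at a general threshold pair `(c₀, c₁)`: **`iiExprT c₀ c₁`** := the cleared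
`Cov_μ(1[b ∈ C₂], 1[a₃ ∈ C₁] (c₁ 1[o ∈ C₂] − c₀))`; `iiExpr = iiExprT D_o D` (`iiExpr_eq_iiExprT`), and
`iiExprT` is LINEAR in `(c₀, c₁)` (**`iiExprT_eq`**: `c₁ A − c₀ B`). The Q-threshold pair is
`(Dqo, P(Q))` with `Dqo = P(Q, o ∈ U)`: **`ZSplitIIQ`** := `0 ≤ iiExprT Dqo P(Q)` — `(ii)` with
`γ_Q = P(o ∈ U ∣ Q)` in place of `γ = P(o ∈ U ∣ PD)`.

Let `a₃` be a leaf at `v` through `e₀` (`IsLeafAt ends v a₃ e₀`; `v, o, a₁, a₂, b ≠ a₃`). Then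
`{a₃ ∈ C₁} = {e₀ open} ∩ {v ∈ C₁}` (`connEvent_leaf_at_eq`), the other events ignore `e₀`, and
* **`iiExpr_eq_of_leaf_at`**: `iiExpr(a₃) = p(e₀) · iiExprT(v; D_o(a₃), D(a₃))`,
* **`Dpd_leaf_at`** / **`Dpdo_leaf_at`**: `D(a₃) = (1 − p(e₀)) P(Q) + p(e₀) D(v)`,
  `D_o(a₃) = (1 − p(e₀)) Dqo + p(e₀) D_o(v)` — the threshold pair of `a₃` is the `p(e₀)`-mixture of the
  Q-pair and the PD-pair of `v`;
so by linearity **`zSplitII_of_leaf_at`**: `(ii)(v) ∧ (ii-Q)(v) ⟹ (ii)(a₃)` — every instance with a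
pendant `a₃` reduces to the instance on `G − a₃` with `v` as `a₃`, at both thresholds (`CaseOnePendant.lean`
is the case `v = a₁`, where `(ii)(a₁)` and `(ii-Q)(a₁)` are BHK 1.3). Conversely the `p → 0` end shows
that `(ii)` on all pendant extensions forces `(ii-Q)`: over all graphs, `(ii)` is equivalent to `(ii)` at
the threshold `min(γ, γ_Q)` (paper, P1-CASEONE.md §7). Nothing beyond the reduction is claimed. -/

namespace Summit.Ventures.PercRepro2

namespace CaseOne

/-! ## `(ii)` at a general threshold pair -/

section Threshold
variable {V : Type*} {E : Type*} [Fintype E] [DecidableEq E] {R : Type*} [CommRing R]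

/-- `1[a₃ ∈ C₁] · (c₁ · 1[o ∈ C₂] − c₀)` — `zFun` at a general threshold pair. -/
noncomputable def zFunT (ends : E → Sym2 V) (o a₁ a₂ a₃ : V) (c₀ c₁ : R) (ω : Config E) : R :=
  (connEvent ends a₁ a₃).indicator 1 ω * (c₁ * (connEvent ends a₂ o).indicator 1 ω - c₀)

/-- **`(ii)` at a general threshold pair**, cleared:
`P(Q) E[1_{b∈C₂} Z 1_Q] − E[1_{b∈C₂} 1_Q] E[Z 1_Q]`, `Z = zFunT c₀ c₁`. -/
noncomputable def iiExprT (p : E → R) (ends : E → Sym2 V) (o a₁ a₂ a₃ b : V) (c₀ c₁ : R) : R :=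
  prob p (connEvent ends a₁ a₂)ᶜ *
      expect p (fun ω => (connEvent ends a₂ b).indicator 1 ω * zFunT ends o a₁ a₂ a₃ c₀ c₁ ω *
        ((connEvent ends a₁ a₂)ᶜ).indicator 1 ω) -
    expect p (fun ω => (connEvent ends a₂ b).indicator 1 ω * ((connEvent ends a₁ a₂)ᶜ).indicator 1 ω) *
      expect p (fun ω => zFunT ends o a₁ a₂ a₃ c₀ c₁ ω * ((connEvent ends a₁ a₂)ᶜ).indicator 1 ω)

/-- `P(Q, o ∈ U)` — the numerator of the Q-threshold `γ_Q = P(o ∈ U ∣ Q)`. -/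
noncomputable def Dqo (p : E → R) (ends : E → Sym2 V) (o a₁ a₂ : V) : R :=
  prob p ((connEvent ends a₁ o ∪ connEvent ends a₂ o) ∩ (connEvent ends a₁ a₂)ᶜ)

/-- `zFun` is `zFunT` at the PD-threshold pair. -/
lemma zFun_eq_zFunT (p : E → R) (ends : E → Sym2 V) (o a₁ a₂ a₃ : V) :
    zFun p ends o a₁ a₂ a₃ = zFunT ends o a₁ a₂ a₃ (Dpdo p ends o a₁ a₂ a₃) (Dpd p ends a₁ a₂ a₃) :=
  rfl

/-- `iiExpr` is `iiExprT` at the PD-threshold pair. -/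
lemma iiExpr_eq_iiExprT (p : E → R) (ends : E → Sym2 V) (o a₁ a₂ a₃ b : V) :
    iiExpr p ends o a₁ a₂ a₃ b =
      iiExprT p ends o a₁ a₂ a₃ b (Dpdo p ends o a₁ a₂ a₃) (Dpd p ends a₁ a₂ a₃) :=
  rfl

/-- **`iiExprT` is linear in the threshold pair**: `iiExprT c₀ c₁ = c₁ · A − c₀ · B` with
`A = P(Q) P(Q, b ∈ C₂, a₃ ∈ C₁, o ∈ C₂) − P(Q, b ∈ C₂) P(Q, a₃ ∈ C₁, o ∈ C₂)` and
`B = P(Q) P(Q, b ∈ C₂, a₃ ∈ C₁) − P(Q, b ∈ C₂) P(Q, a₃ ∈ C₁)`. -/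
theorem iiExprT_eq (p : E → R) (ends : E → Sym2 V) (o a₁ a₂ a₃ b : V) (c₀ c₁ : R) :
    iiExprT p ends o a₁ a₂ a₃ b c₀ c₁ =
      c₁ * (prob p (connEvent ends a₁ a₂)ᶜ *
          prob p (connEvent ends a₂ b ∩ connEvent ends a₁ a₃ ∩ connEvent ends a₂ o ∩
            (connEvent ends a₁ a₂)ᶜ) -
        prob p (connEvent ends a₂ b ∩ (connEvent ends a₁ a₂)ᶜ) *
          prob p (connEvent ends a₁ a₃ ∩ connEvent ends a₂ o ∩ (connEvent ends a₁ a₂)ᶜ)) -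
      c₀ * (prob p (connEvent ends a₁ a₂)ᶜ *
          prob p (connEvent ends a₂ b ∩ connEvent ends a₁ a₃ ∩ (connEvent ends a₁ a₂)ᶜ) -
        prob p (connEvent ends a₂ b ∩ (connEvent ends a₁ a₂)ᶜ) *
          prob p (connEvent ends a₁ a₃ ∩ (connEvent ends a₁ a₂)ᶜ)) := by
  unfold iiExprT zFunT
  have e1 : expect p (fun ω => (connEvent ends a₂ b).indicator (1 : Config E → R) ω *
      ((connEvent ends a₁ a₃).indicator 1 ω *
        (c₁ * (connEvent ends a₂ o).indicator 1 ω - c₀)) *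
      ((connEvent ends a₁ a₂)ᶜ).indicator 1 ω) =
      expect p (fun ω => ((connEvent ends a₂ b).indicator (1 : Config E → R) ω *
        (connEvent ends a₁ a₃).indicator 1 ω) *
        (c₁ * (connEvent ends a₂ o).indicator 1 ω - c₀) *
        ((connEvent ends a₁ a₂)ᶜ).indicator 1 ω) := by
    congr 1
    funext ω
    ring
  rw [e1, expect_mul_affine, expect_mul_affine]
  simp only [expect_ind4, expect_ind3, expect_ind2]
  ring

end Threshold

section ThresholdProp
variable {V : Type*} {E : Type*} [Fintype E] [DecidableEq E] {R : Type*} [CommRing R] [LinearOrder R]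

/-- **`(ii-Q)`**: `(ii)` at the Q-threshold pair `(P(Q, o ∈ U), P(Q))`, i.e. with
`γ_Q = P(o ∈ U ∣ Q)` in place of `γ`. A definition only. -/
def ZSplitIIQ (p : E → R) (ends : E → Sym2 V) (o a₁ a₂ a₃ b : V) : Prop :=
  0 ≤ iiExprT p ends o a₁ a₂ a₃ b (Dqo p ends o a₁ a₂) (prob p (connEvent ends a₁ a₂)ᶜ)

end ThresholdProp

/-! ## A leaf at any vertex -/

section LeafAt
variable {V : Type*} {E : Type*} [DecidableEq E]
variable {ends : E → Sym2 V} {v a₃ : V} {e₀ : E}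

omit [DecidableEq E] in
/-- `a₁ ↔ a₃ ⟺ e₀ open ∧ a₁ ↔ v` when `a₃` is a leaf at `v` (`a₁ ≠ a₃`). -/
lemma conn_leaf_at_iff (hl : IsLeafAt ends v a₃ e₀) (ω : Config E) {a₁ : V} (h1 : a₁ ≠ a₃) :
    Conn ends ω a₁ a₃ ↔ ω e₀ = true ∧ Conn ends ω a₁ v := by
  constructor
  · intro h
    have hω : ω e₀ = true := by
      by_contra hne
      have hω' : ω e₀ = false := by simpa using hne
      exact h1 (eq_of_conn_leaf_of_closed hl hω' (conn_symm h))
    refine ⟨hω, conn_trans h (conn_of_openAdj ⟨e₀, hω, ?_⟩)⟩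
    rw [hl.ends_eq, Sym2.eq_swap]
  · rintro ⟨hω, h⟩
    exact conn_trans h (conn_of_openAdj ⟨e₀, hω, hl.ends_eq⟩)

omit [DecidableEq E] in
/-- `{a₃ ∈ C₁} = {e₀ open} ∩ {v ∈ C₁}`. -/
lemma connEvent_leaf_at_eq (hl : IsLeafAt ends v a₃ e₀) {a₁ : V} (h1 : a₁ ≠ a₃) :
    connEvent ends a₁ a₃ = openEdge e₀ ∩ connEvent ends a₁ v := by
  ext ω
  exact conn_leaf_at_iff hl ω h1

variable {R : Type*} [CommRing R]

omit [DecidableEq E] in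
/-- The indicator of `{a₃ ∈ C₁}` factorises as `1[e₀ open] · 1[v ∈ C₁]`. -/
lemma indicator_leaf_at (hl : IsLeafAt ends v a₃ e₀) {a₁ : V} (h1 : a₁ ≠ a₃) (ω : Config E) :
    (connEvent ends a₁ a₃).indicator (1 : Config E → R) ω =
      (openEdge e₀).indicator 1 ω * (connEvent ends a₁ v).indicator 1 ω := by
  rw [connEvent_leaf_at_eq hl h1, ind_mul]

end LeafAt

/-! ## The reduction -/

section Reduction
variable {V : Type*} {E : Type*} [Fintype E] [DecidableEq E] {R : Type*} [CommRing R]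
variable {ends : E → Sym2 V} {v a₃ : V} {e₀ : E}

/-- **`iiExpr(a₃) = p(e₀) · iiExprT(v; D_o(a₃), D(a₃))`** when `a₃` is a leaf at `v`
(`o, a₁, a₂, b ≠ a₃`). -/
theorem iiExpr_eq_of_leaf_at (p : E → R) (hl : IsLeafAt ends v a₃ e₀) (o a₁ a₂ b : V)
    (ho : o ≠ a₃) (h1 : a₁ ≠ a₃) (h2 : a₂ ≠ a₃) (hb : b ≠ a₃) :
    iiExpr p ends o a₁ a₂ a₃ b = p e₀ *
      iiExprT p ends o a₁ a₂ v b (Dpdo p ends o a₁ a₂ a₃) (Dpd p ends a₁ a₂ a₃) := by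
  unfold iiExpr iiExprT zFun zFunT
  set D := Dpd p ends a₁ a₂ a₃
  set Do := Dpdo p ends o a₁ a₂ a₃
  simp only [indicator_leaf_at hl h1]
  have hv : v ≠ a₃ := hl.ne
  have e1 : expect p (fun ω => (connEvent ends a₂ b).indicator (1 : Config E → R) ω *
      ((openEdge e₀).indicator 1 ω * (connEvent ends a₁ v).indicator 1 ω *
        (D * (connEvent ends a₂ o).indicator 1 ω - Do)) *
      ((connEvent ends a₁ a₂)ᶜ).indicator 1 ω) =
      p e₀ * expect p (fun ω => (connEvent ends a₂ b).indicator (1 : Config E → R) ω *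
        ((connEvent ends a₁ v).indicator 1 ω * (D * (connEvent ends a₂ o).indicator 1 ω - Do)) *
        ((connEvent ends a₁ a₂)ᶜ).indicator 1 ω) := by
    have : (fun ω => (connEvent ends a₂ b).indicator (1 : Config E → R) ω *
        ((openEdge e₀).indicator 1 ω * (connEvent ends a₁ v).indicator 1 ω *
          (D * (connEvent ends a₂ o).indicator 1 ω - Do)) *
        ((connEvent ends a₁ a₂)ᶜ).indicator 1 ω) =
        fun ω => ((connEvent ends a₂ b).indicator (1 : Config E → R) ω *
          ((connEvent ends a₁ v).indicator 1 ω * (D * (connEvent ends a₂ o).indicator 1 ω - Do)) *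
          ((connEvent ends a₁ a₂)ᶜ).indicator 1 ω) * (openEdge e₀).indicator 1 ω := by
      funext ω; ring
    rw [this, expect_mul_openEdge_of_ignore p e₀ _ (fun ω c => by
      simp only [Set.indicator_compl, Pi.one_apply, Pi.sub_apply]
      rw [connEvent_indicator_update_of_leaf hl ω c h2 hb,
        connEvent_indicator_update_of_leaf hl ω c h1 hv,
        connEvent_indicator_update_of_leaf hl ω c h2 ho,
        connEvent_indicator_update_of_leaf hl ω c h1 h2])]
  have e2 : expect p (fun ω => (openEdge e₀).indicator (1 : Config E → R) ω *
      (connEvent ends a₁ v).indicator 1 ω * (D * (connEvent ends a₂ o).indicator 1 ω - Do) *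
      ((connEvent ends a₁ a₂)ᶜ).indicator 1 ω) =
      p e₀ * expect p (fun ω => (connEvent ends a₁ v).indicator (1 : Config E → R) ω *
        (D * (connEvent ends a₂ o).indicator 1 ω - Do) * ((connEvent ends a₁ a₂)ᶜ).indicator 1 ω) := by
    have : (fun ω => (openEdge e₀).indicator (1 : Config E → R) ω *
        (connEvent ends a₁ v).indicator 1 ω * (D * (connEvent ends a₂ o).indicator 1 ω - Do) *
        ((connEvent ends a₁ a₂)ᶜ).indicator 1 ω) =
        fun ω => ((connEvent ends a₁ v).indicator (1 : Config E → R) ω *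
          (D * (connEvent ends a₂ o).indicator 1 ω - Do) *
          ((connEvent ends a₁ a₂)ᶜ).indicator 1 ω) * (openEdge e₀).indicator 1 ω := by
      funext ω; ring
    rw [this, expect_mul_openEdge_of_ignore p e₀ _ (fun ω c => by
      simp only [Set.indicator_compl, Pi.one_apply, Pi.sub_apply]
      rw [connEvent_indicator_update_of_leaf hl ω c h1 hv,
        connEvent_indicator_update_of_leaf hl ω c h2 ho,
        connEvent_indicator_update_of_leaf hl ω c h1 h2])]
  rw [e1, e2]
  ring

/-- `P(A ∩ {e open}) = p(e) · P(A)` for an event `A` that ignores `e`. -/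
lemma prob_inter_openEdge_of_ignore (p : E → R) (e : E) (A : Set (Config E))
    (hA : ∀ ω c, A.indicator (1 : Config E → R) (Function.update ω e c) = A.indicator 1 ω) :
    prob p (A ∩ openEdge e) = p e * prob p A := by
  rw [prob_eq_expect_indicator, prob_eq_expect_indicator]
  have : (A ∩ openEdge e).indicator (1 : Config E → R) =
      fun ω => A.indicator 1 ω * (openEdge e).indicator 1 ω := by
    funext ω; rw [ind_mul]
  rw [this]
  exact expect_mul_openEdge_of_ignore p e _ hA

/-- `P(A ∩ {e closed}) = (1 − p(e)) · P(A)` for an event `A` that ignores `e`. -/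
lemma prob_inter_closedEdge_of_ignore (p : E → R) (e : E) (A : Set (Config E))
    (hA : ∀ ω c, A.indicator (1 : Config E → R) (Function.update ω e c) = A.indicator 1 ω) :
    prob p (A ∩ closedEdge e) = (1 - p e) * prob p A := by
  have h := prob_inter_add_prob_inter_compl p A (openEdge e)
  rw [← closedEdge_eq_compl, prob_inter_openEdge_of_ignore p e A hA] at h
  linear_combination h

omit [Fintype E] [DecidableEq E] in
/-- `{a₃ ∉ U} = {e₀ closed} ∪ ({e₀ open} ∩ {v ∉ U})` when `a₃` is a leaf at `v`. -/
lemma notMemU_leaf_at (hl : IsLeafAt ends v a₃ e₀) {a₁ a₂ : V} (h1 : a₁ ≠ a₃) (h2 : a₂ ≠ a₃) :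
    (connEvent ends a₁ a₃)ᶜ ∩ (connEvent ends a₂ a₃)ᶜ =
      closedEdge e₀ ∪ (openEdge e₀ ∩ ((connEvent ends a₁ v)ᶜ ∩ (connEvent ends a₂ v)ᶜ)) := by
  rw [connEvent_leaf_at_eq hl h1, connEvent_leaf_at_eq hl h2]
  ext ω
  simp only [Set.mem_inter_iff, Set.mem_compl_iff, Set.mem_union, openEdge, closedEdge,
    Set.mem_setOf_eq]
  cases ω e₀ <;> simp

omit [Fintype E] in
/-- The indicator of an intersection of events ignoring `e₀` ignores `e₀`. -/
lemma indicator_inter_ignore {A B : Set (Config E)} {e : E}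
    (hA : ∀ ω c, A.indicator (1 : Config E → R) (Function.update ω e c) = A.indicator 1 ω)
    (hB : ∀ ω c, B.indicator (1 : Config E → R) (Function.update ω e c) = B.indicator 1 ω) :
    ∀ ω c, (A ∩ B).indicator (1 : Config E → R) (Function.update ω e c) = (A ∩ B).indicator 1 ω := by
  intro ω c
  rw [← ind_mul, ← ind_mul, hA, hB]

omit [Fintype E] in
/-- The indicator of a union of events ignoring `e₀` ignores `e₀`. -/
lemma indicator_union_ignore {A B : Set (Config E)} {e : E}
    (hA : ∀ ω c, A.indicator (1 : Config E → R) (Function.update ω e c) = A.indicator 1 ω)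
    (hB : ∀ ω c, B.indicator (1 : Config E → R) (Function.update ω e c) = B.indicator 1 ω) :
    ∀ ω c, (A ∪ B).indicator (1 : Config E → R) (Function.update ω e c) = (A ∪ B).indicator 1 ω := by
  intro ω c
  have key : ∀ ω' : Config E, (A ∪ B).indicator (1 : Config E → R) ω' =
      A.indicator 1 ω' + B.indicator 1 ω' - A.indicator 1 ω' * B.indicator 1 ω' := by
    intro ω'
    by_cases ha : ω' ∈ A <;> by_cases hb : ω' ∈ B <;> simp [ha, hb]
  rw [key, key, hA, hB]

omit [Fintype E] in
/-- The indicator of the complement of an event ignoring `e₀` ignores `e₀`. -/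
lemma indicator_compl_ignore {A : Set (Config E)} {e : E}
    (hA : ∀ ω c, A.indicator (1 : Config E → R) (Function.update ω e c) = A.indicator 1 ω) :
    ∀ ω c, Aᶜ.indicator (1 : Config E → R) (Function.update ω e c) = Aᶜ.indicator 1 ω := by
  intro ω c
  simp only [Set.indicator_compl, Pi.one_apply, Pi.sub_apply]
  rw [hA]

/-- **`D(a₃) = (1 − p(e₀)) P(Q) + p(e₀) D(v)`** when `a₃` is a leaf at `v`. -/
theorem Dpd_leaf_at (p : E → R) (hl : IsLeafAt ends v a₃ e₀) (a₁ a₂ : V) (h1 : a₁ ≠ a₃)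
    (h2 : a₂ ≠ a₃) :
    Dpd p ends a₁ a₂ a₃ =
      (1 - p e₀) * prob p (connEvent ends a₁ a₂)ᶜ + p e₀ * Dpd p ends a₁ a₂ v := by
  have hv : v ≠ a₃ := hl.ne
  unfold Dpd
  rw [notMemU_leaf_at hl h1 h2, Set.union_inter_distrib_right]
  have hdisj : Disjoint (closedEdge e₀ ∩ (connEvent ends a₁ a₂)ᶜ)
      (openEdge e₀ ∩ ((connEvent ends a₁ v)ᶜ ∩ (connEvent ends a₂ v)ᶜ) ∩ (connEvent ends a₁ a₂)ᶜ) := by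
    rw [Set.disjoint_left]
    rintro ω ⟨hc, _⟩ ⟨⟨ho, _⟩, _⟩
    simp only [closedEdge, openEdge, Set.mem_setOf_eq] at hc ho
    rw [hc] at ho; exact Bool.noConfusion ho
  rw [prob_union_of_disjoint p hdisj, Set.inter_comm (closedEdge e₀),
    prob_inter_closedEdge_of_ignore p e₀ _ (indicator_compl_ignore (R := R)
      (fun ω c => connEvent_indicator_update_of_leaf hl ω c h1 h2))]
  have e2 : openEdge e₀ ∩ ((connEvent ends a₁ v)ᶜ ∩ (connEvent ends a₂ v)ᶜ) ∩
      (connEvent ends a₁ a₂)ᶜ =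
      ((connEvent ends a₁ v)ᶜ ∩ (connEvent ends a₂ v)ᶜ ∩ (connEvent ends a₁ a₂)ᶜ) ∩ openEdge e₀ := by
    ext ω; simp only [Set.mem_inter_iff]; tauto
  rw [e2, prob_inter_openEdge_of_ignore p e₀ _ (indicator_inter_ignore (R := R)
    (indicator_inter_ignore (indicator_compl_ignore
      (fun ω c => connEvent_indicator_update_of_leaf hl ω c h1 hv))
      (indicator_compl_ignore (fun ω c => connEvent_indicator_update_of_leaf hl ω c h2 hv)))
    (indicator_compl_ignore (fun ω c => connEvent_indicator_update_of_leaf hl ω c h1 h2)))]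

/-- **`D_o(a₃) = (1 − p(e₀)) P(Q, o ∈ U) + p(e₀) D_o(v)`** when `a₃` is a leaf at `v`. -/
theorem Dpdo_leaf_at (p : E → R) (hl : IsLeafAt ends v a₃ e₀) (o a₁ a₂ : V) (ho : o ≠ a₃)
    (h1 : a₁ ≠ a₃) (h2 : a₂ ≠ a₃) :
    Dpdo p ends o a₁ a₂ a₃ = (1 - p e₀) * Dqo p ends o a₁ a₂ + p e₀ * Dpdo p ends o a₁ a₂ v := by
  have hv : v ≠ a₃ := hl.ne
  unfold Dpdo Dqo
  have hU : (connEvent ends a₁ o ∪ connEvent ends a₂ o) ∩ (connEvent ends a₁ a₃)ᶜ ∩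
      (connEvent ends a₂ a₃)ᶜ ∩ (connEvent ends a₁ a₂)ᶜ =
      ((connEvent ends a₁ o ∪ connEvent ends a₂ o) ∩ (connEvent ends a₁ a₂)ᶜ) ∩ closedEdge e₀ ∪
        ((connEvent ends a₁ o ∪ connEvent ends a₂ o) ∩ (connEvent ends a₁ v)ᶜ ∩
          (connEvent ends a₂ v)ᶜ ∩ (connEvent ends a₁ a₂)ᶜ) ∩ openEdge e₀ := by
    have := notMemU_leaf_at hl h1 h2
    ext ω
    have hω := Set.ext_iff.1 this ω
    simp only [Set.mem_inter_iff, Set.mem_compl_iff, Set.mem_union] at hω ⊢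
    tauto
  have hdisj : Disjoint (((connEvent ends a₁ o ∪ connEvent ends a₂ o) ∩ (connEvent ends a₁ a₂)ᶜ) ∩
      closedEdge e₀)
      (((connEvent ends a₁ o ∪ connEvent ends a₂ o) ∩ (connEvent ends a₁ v)ᶜ ∩
        (connEvent ends a₂ v)ᶜ ∩ (connEvent ends a₁ a₂)ᶜ) ∩ openEdge e₀) := by
    rw [Set.disjoint_left]
    rintro ω ⟨_, hc⟩ ⟨_, ho'⟩
    simp only [closedEdge, openEdge, Set.mem_setOf_eq] at hc ho'
    rw [hc] at ho'; exact Bool.noConfusion ho'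
  have hoU : ∀ ω c, (connEvent ends a₁ o ∪ connEvent ends a₂ o).indicator (1 : Config E → R)
      (Function.update ω e₀ c) = (connEvent ends a₁ o ∪ connEvent ends a₂ o).indicator 1 ω :=
    indicator_union_ignore (fun ω c => connEvent_indicator_update_of_leaf hl ω c h1 ho)
      (fun ω c => connEvent_indicator_update_of_leaf hl ω c h2 ho)
  have hQ : ∀ ω c, ((connEvent ends a₁ a₂)ᶜ).indicator (1 : Config E → R)
      (Function.update ω e₀ c) = ((connEvent ends a₁ a₂)ᶜ).indicator 1 ω :=
    indicator_compl_ignore (fun ω c => connEvent_indicator_update_of_leaf hl ω c h1 h2)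
  rw [hU, prob_union_of_disjoint p hdisj,
    prob_inter_closedEdge_of_ignore p e₀ _ (indicator_inter_ignore hoU hQ),
    prob_inter_openEdge_of_ignore p e₀ _ (indicator_inter_ignore (indicator_inter_ignore
      (indicator_inter_ignore hoU (indicator_compl_ignore
        (fun ω c => connEvent_indicator_update_of_leaf hl ω c h1 hv)))
      (indicator_compl_ignore (fun ω c => connEvent_indicator_update_of_leaf hl ω c h2 hv))) hQ)]

end Reduction

/-! ## The theorem -/

section Theorem
variable {V : Type*} {E : Type*} [Fintype E] [DecidableEq E] {R : Type*} [CommRing R]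
  [LinearOrder R] [IsStrictOrderedRing R]
variable {ends : E → Sym2 V} {v a₃ : V} {e₀ : E}

omit [LinearOrder R] [IsStrictOrderedRing R] in
/-- `iiExprT` at a mixture of threshold pairs is the mixture of the `iiExprT`s. -/
lemma iiExprT_mix (p : E → R) (ends : E → Sym2 V) (o a₁ a₂ a₃ b : V) (t c₀ c₁ c₀' c₁' : R) :
    iiExprT p ends o a₁ a₂ a₃ b ((1 - t) * c₀ + t * c₀') ((1 - t) * c₁ + t * c₁') =
      (1 - t) * iiExprT p ends o a₁ a₂ a₃ b c₀ c₁ + t * iiExprT p ends o a₁ a₂ a₃ b c₀' c₁' := by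
  rw [iiExprT_eq, iiExprT_eq, iiExprT_eq]
  ring

/-- **The pendant-`a₃` reduction**: if `a₃` is a leaf at `v` (`o, a₁, a₂, b ≠ a₃`), then `(ii)` at `v`
and `(ii-Q)` at `v` give `(ii)` at `a₃` — by linearity of `iiExprT` in the threshold pair and the
mixture identities `Dpd_leaf_at` / `Dpdo_leaf_at`. -/
theorem zSplitII_of_leaf_at (p : E → R) (hp : IsProbVec p) (hl : IsLeafAt ends v a₃ e₀)
    (o a₁ a₂ b : V) (ho : o ≠ a₃) (h1 : a₁ ≠ a₃) (h2 : a₂ ≠ a₃) (hb : b ≠ a₃)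
    (hPD : ZSplitII p ends o a₁ a₂ v b) (hQ : ZSplitIIQ p ends o a₁ a₂ v b) :
    ZSplitII p ends o a₁ a₂ a₃ b := by
  unfold ZSplitII at hPD ⊢
  unfold ZSplitIIQ at hQ
  rw [iiExpr_eq_iiExprT] at hPD
  rw [iiExpr_eq_of_leaf_at p hl o a₁ a₂ b ho h1 h2 hb, Dpd_leaf_at p hl a₁ a₂ h1 h2,
    Dpdo_leaf_at p hl o a₁ a₂ ho h1 h2, iiExprT_mix]
  have hp0 : 0 ≤ p e₀ := hp.nonneg e₀
  have hp1 : 0 ≤ 1 - p e₀ := by linarith [hp.le_one e₀]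
  exact mul_nonneg hp0 (add_nonneg (mul_nonneg hp1 hQ) (mul_nonneg hp0 hPD))

end Theorem

end CaseOne

end Summit.Ventures.PercRepro2
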